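import Summits.AnomalousDissipation.AnomalousDissipation.Theorems.SawtoothPulseCascadeK1LocalisedCascadeIterateGradient
import Summits.AnomalousDissipation.AnomalousDissipation.Theorems.SawtoothPulseCascadeK1LocalisedCascadeAxisBlock

/-!
# K1loc, line `Spectral` — S-D (first good piece): ASSEMBLY OF THE START SOCKET FROM LINE MEANS

Helper file of the prover lane on the crux `K1LocalisedCascade` (stmt-AnomalousDissipation-19491), route
`SawtoothPulseCascade`, registered line `Cruxes.K1LocalisedCascade.Spectral` (one open stub `stub_highModeConcentration`).
This file pins the INTERFACE of the analytic first good piece (memo v8): the ledger's start hypothesis `hstart` for the cascade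
datum follows from THREE numbers about the explicit inviscid iterate `a_n` —

* a bound `∫ g² ≤ Γ` for a square-integrable majorant `g` of the line means, `|axisAvg 0 (a n) x| ≤ g x` (channel (L-a): the per-line
  cell count, memo v8 §7–§8, typically `g = β + 1_{Bad}`-type),
* a bound `Λ` for the energy of `a_n` on the rest `R` of the start bad set (channel (L-b): ball and near-stable slabs),
* and the threshold `κ₁` (the `κ → 0` transfer, `…IterateGradient.sqrt_tsum_symbol_sq_datum_le_of_inviscid`):

for every real symbol `|μ| ≤ 1` supported in the column `{k₀ = 0}` and `R`,
`hstart` holds with `q₀ = √(Γ + Λ) + (2π√(1+(1+γ)²)(1+γ)^{2n}√(2κ₁ · tStart n · ‖datum‖²))^{1/2}`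
(`sqrt_tsum_symbol_sq_datum_le_of_lineMean`).  Ingredients: `…AxisBlock.tsum_axisBlock_real_eq` (column energy = `∫ (axisAvg)²`),
Parseval summability, and the start transfer.

WHAT THIS IS NOT: no value of `Γ`, `Λ` (memo v8 §7–§8 and (L-b)); bookkeeping only. [cite: Grafakos2014, Prop. 3.2.7 (3) (Parseval)]
[cite: DEIJ2022, (1.2)–(1.3)] [problem: turb]
-/

-- `Summit.<Summit>.<Problem>`: single-conjunct summit, the duplicate namespace segment is deliberate.
set_option linter.dupNamespace false

noncomputable section

namespace Summit.AnomalousDissipation.AnomalousDissipation.Theorems.SawtoothPulseCascade.K1Start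

open MeasureTheory Set Filter Topology UnitAddTorus Function
open Literature.Analysis Literature.Analysis.FunctionSpaces Literature.Analysis.FunctionSpaces.Torus
open Literature.Analysis.FluidPDE.ShearStage
open Literature.Analysis.FluidPDE.SawtoothCascade Literature.Analysis.FluidPDE.SawtoothCascade.CascadeParams

/-! ## §1 Splitting a tracked energy over the column and the rest -/

/-- **Column energy from a square-integrable majorant of the line means**: if `|axisAvg 0 θ x| ≤ g x` for all `x` with `g²` integrable,
then `Σ' k, [k₀ = 0]·‖𝓕θ(k)‖² ≤ ∫ g²` (`θ` smooth). [cite: Grafakos2014, Prop. 3.2.7 (3)] -/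
theorem tsum_axisBlock_real_le_of_integrable {θ : UnitAddTorus (Fin 2) → ℝ} (hθ : IsSmooth θ) {g : UnitAddTorus (Fin 2) → ℝ}
    (hg : Integrable (fun x => g x ^ 2)) (hle : ∀ x, |axisAvg 0 θ x| ≤ g x) :
    ∑' k : Fin 2 → ℤ, (if k 0 = 0 then (1 : ℝ) else 0) * ‖mFourierCoeff (fun x => (θ x : ℂ)) k‖ ^ 2 ≤ ∫ x, g x ^ 2 := by
  rw [tsum_axisBlock_real_eq hθ 0]
  refine integral_mono_of_nonneg (Eventually.of_forall fun x => sq_nonneg _) hg (Eventually.of_forall fun x => ?_)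
  show axisAvg 0 θ x ^ 2 ≤ g x ^ 2
  rw [← sq_abs]
  exact pow_le_pow_left₀ (abs_nonneg _) (hle x) 2

/-- **A symbol supported in the column and a rest set.**  For a smooth real `θ`, a real symbol `|μ| ≤ 1` vanishing off
`{k₀ = 0} ∪ R`, a line-mean majorant `g` (`∫ g² ≤ Γ`) and a bound `Λ` for the energy of `θ` on `R`:
`√(Σ' μ²‖𝓕θ‖²) ≤ √(Γ + Λ)`. [cite: Grafakos2014, Prop. 3.2.7 (3)] -/
theorem sqrt_tsum_symbol_sq_le_sqrt_add {θ : UnitAddTorus (Fin 2) → ℝ} (hθ : IsSmooth θ) (μ : (Fin 2 → ℤ) → ℝ)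
    (hμ1 : ∀ k, |μ k| ≤ 1) (R : Set (Fin 2 → ℤ)) [DecidablePred (· ∈ R)] (hμ : ∀ k, k 0 ≠ 0 → k ∉ R → μ k = 0)
    {g : UnitAddTorus (Fin 2) → ℝ} (hg : Integrable (fun x => g x ^ 2)) (hle : ∀ x, |axisAvg 0 θ x| ≤ g x) {Γ Λ : ℝ}
    (hΓ : ∫ x, g x ^ 2 ≤ Γ)
    (hΛ : ∑' k : Fin 2 → ℤ, (if k ∈ R then (1 : ℝ) else 0) * ‖mFourierCoeff (fun x => (θ x : ℂ)) k‖ ^ 2 ≤ Λ) :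
    Real.sqrt (∑' k : Fin 2 → ℤ, μ k ^ 2 * ‖mFourierCoeff (fun x => (θ x : ℂ)) k‖ ^ 2) ≤ Real.sqrt (Γ + Λ) := by
  refine Real.sqrt_le_sqrt ?_
  have hθc : Continuous fun x => (θ x : ℂ) := Complex.continuous_ofReal.comp hθ.continuous
  have hP := hasSum_sq_mFourierCoeff_of_continuous hθc
  set E : (Fin 2 → ℤ) → ℝ := fun k => ‖mFourierCoeff (fun x => (θ x : ℂ)) k‖ ^ 2 with hE
  have hE0 : ∀ k, 0 ≤ E k := fun k => sq_nonneg _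
  -- pointwise: `μ² E ≤ [k₀ = 0] E + [k ∈ R] E`
  have hpt : ∀ k, μ k ^ 2 * E k ≤ (if k 0 = 0 then (1 : ℝ) else 0) * E k + (if k ∈ R then (1 : ℝ) else 0) * E k := by
    intro k
    have hμ2 : μ k ^ 2 ≤ 1 := by
      have h := hμ1 k; rw [← sq_abs]; nlinarith [abs_nonneg (μ k)]
    by_cases h0 : k 0 = 0
    · rw [if_pos h0]
      have : 0 ≤ (if k ∈ R then (1 : ℝ) else 0) * E k := mul_nonneg (by split_ifs <;> norm_num) (hE0 k)
      nlinarith [hE0 k]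
    · by_cases hR : k ∈ R
      · rw [if_neg h0, if_pos hR]; nlinarith [hE0 k]
      · rw [hμ k h0 hR]; simp only [if_neg h0, if_neg hR]; nlinarith [hE0 k]
  -- summability of the three series (all dominated by Parseval)
  have hs1 : Summable fun k => (if k 0 = 0 then (1 : ℝ) else 0) * E k :=
    (hP.summable.mul_left 1).of_nonneg_of_le (fun k => mul_nonneg (by split_ifs <;> norm_num) (hE0 k)) fun k => by
      refine mul_le_mul_of_nonneg_right ?_ (hE0 k); split_ifs <;> norm_num
  have hs2 : Summable fun k => (if k ∈ R then (1 : ℝ) else 0) * E k :=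
    (hP.summable.mul_left 1).of_nonneg_of_le (fun k => mul_nonneg (by split_ifs <;> norm_num) (hE0 k)) fun k => by
      refine mul_le_mul_of_nonneg_right ?_ (hE0 k); split_ifs <;> norm_num
  have hsμ : Summable fun k => μ k ^ 2 * E k :=
    (hs1.add hs2).of_nonneg_of_le (fun k => mul_nonneg (sq_nonneg _) (hE0 k)) hpt
  calc ∑' k, μ k ^ 2 * E k ≤ ∑' k, ((if k 0 = 0 then (1 : ℝ) else 0) * E k + (if k ∈ R then (1 : ℝ) else 0) * E k) :=
        hsμ.tsum_le_tsum hpt (hs1.add hs2)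
    _ = (∑' k, (if k 0 = 0 then (1 : ℝ) else 0) * E k) + ∑' k, (if k ∈ R then (1 : ℝ) else 0) * E k := hs1.tsum_add hs2
    _ ≤ Γ + Λ := add_le_add ((tsum_axisBlock_real_le_of_integrable hθ hg hle).trans hΓ) hΛ

/-! ## §2 The start socket of the ledger from the three numbers -/

section Cascade

variable (P : CascadeParams)

/-- **`hstart` from line means.**  Let `(a, b)` be the inviscid iterate of the cascade datum (`…StartTransfer` recursion), `μ` a real symbol
with `|μ| ≤ 1` vanishing off the column `{k₀ = 0}` and a rest set `R`; suppose the line means of `a_n` have a square-integrable majorant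
`g` with `∫ g² ≤ Γ`, and the energy of `a_n` on `R` is `≤ Λ`.  Then for every `κ ∈ (0, κ₁]` every classical cascade scalar `w` from the
datum satisfies `√(Σ' μ(k)²|𝓕(w(tStart n))(k)|²) ≤ √(Γ + Λ) + (2π√(1+(1+γ)²)(1+γ)^{2n}√(2κ₁·tStart n·‖datum‖²))^{1/2}` —
the hypothesis `hstart` of `…K1Ledger.highModeConcentration_of_ledger_threshold` with `i₀ = n`.
[cite: DEIJ2022, (1.2)–(1.3)] [cite: Grafakos2014, Prop. 3.2.7 (3)] -/
theorem sqrt_tsum_symbol_sq_datum_le_of_lineMean (hγ : 0 ≤ P.γ) (hδ₀ : 0 < P.δ₀) (hd : 0 < P.d)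
    (a b : ℕ → UnitAddTorus (Fin 2) → ℝ) (has : ∀ j, IsSmooth (a j)) (h0 : a 0 = datum)
    (hb : ∀ j, b j = a j ∘ shearMap 0 1 (amp ⟨P.U j, P.U_periodic j, P.contDiff_U (P.δ_pos hδ₀ hd j)⟩ P.γ))
    (hab : ∀ j, a (j + 1) = b j ∘ shearMap 1 0 (amp ⟨P.U j, P.U_periodic j, P.contDiff_U (P.δ_pos hδ₀ hd j)⟩ P.γ))
    (n : ℕ) (μ : (Fin 2 → ℤ) → ℝ) (hμ1 : ∀ k, |μ k| ≤ 1) (R : Set (Fin 2 → ℤ)) [DecidablePred (· ∈ R)]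
    (hμ : ∀ k, k 0 ≠ 0 → k ∉ R → μ k = 0)
    {g : UnitAddTorus (Fin 2) → ℝ} (hg : Integrable (fun x => g x ^ 2)) (hle : ∀ x, |axisAvg 0 (a n) x| ≤ g x) {Γ Λ : ℝ}
    (hΓ : ∫ x, g x ^ 2 ≤ Γ)
    (hΛ : ∑' k : Fin 2 → ℤ, (if k ∈ R then (1 : ℝ) else 0) * ‖mFourierCoeff (fun x => (a n x : ℂ)) k‖ ^ 2 ≤ Λ) {κ₁ : ℝ} :
    ∀ κ ∈ Ioc (0 : ℝ) κ₁, ∀ w : ℝ → UnitAddTorus (Fin 2) → ℝ,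
      FluidPDE.Torus.IsClassicalScalarTransportOn (Ico 0 1) κ P.field w → w 0 = datum →
        Real.sqrt (∑' k, μ k ^ 2 * ‖mFourierCoeff (fun x => (w (tStart n) x : ℂ)) k‖ ^ 2) ≤
          Real.sqrt (Γ + Λ) + Real.sqrt (2 * Real.pi * Real.sqrt (1 + (1 + P.γ) ^ 2) * (1 + P.γ) ^ (2 * n) *
            Real.sqrt (2 * κ₁ * tStart n * FluidPDE.Torus.scalarL2Sq datum)) :=
  sqrt_tsum_symbol_sq_datum_le_of_inviscid P hγ hδ₀ hd a b has h0 hb hab n μ hμ1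
    (sqrt_tsum_symbol_sq_le_sqrt_add (has n) μ hμ1 R hμ hg hle hΓ hΛ)

end Cascade

end Summit.AnomalousDissipation.AnomalousDissipation.Theorems.SawtoothPulseCascade.K1Start
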